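import Summits.ResolutionOfSingularities.ResolutionOfSingularities.Theorems.HilbertSamuelEliminationSigmaMaxModificationsCorridor3WLadderIsoTailsArcLimitDegree
import Mathlib.RingTheory.MvPowerSeries.Substitution
import HarnessLib

/-!
# [OURS · L1 W4.2 · D14 ROUTE G v2 «ARC LIMIT» · G2c, file 2] Layers and the scaling `y ↦ tⁿ y` in `K⟦t, y_1, …, y_d⟧`

Sub-problem `ResolutionOfSingularities`, crux `SigmaMaxModifications` / conjunct `SigmaMaxModificationsCorridor3`
(route `HilbertSamuelElimination`, line `w_ladder`), idea chain L1 C5 «K1 FREE-RATIONAL TAILS», ROUTE G v2 (memo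
`L/res-L1-w42-lead-1/ROUTE-G-ARCLIMIT.md` 96c77a196e17bc23), over `…IsoTailsArcLimitDegree` (`yDeg`, `arcIdeal = P₀`,
`mem_arcIdeal_pow_iff`).

* `layer j = weightedHomogeneousComponent yW j` — the `y`-homogeneous LAYER of degree `j` (a "polynomial of degree `j` in `y` with
  coefficients in `K⟦t⟧"): `layer_mem_arcIdeal_pow`, `sub_layer_mem_arcIdeal_pow_succ`, `layer_eq_zero_of_mem_pow`,
  `mem_arcIdeal_pow_iff_layer`, the product rule `layer_mul_of_isWeightedHomogeneous` (`layer j (a * φ) = layer (j - i) a * φ`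
  for `φ` homogeneous of degree `i ≤ j`) and `layer_X_zero_pow_mul`;
* `scale n` — the `n`-fold chart substitution `t ↦ t, y_i ↦ tⁿ y_i` (= `chartSubstSeries` of `…IsoProximityDefs` at `d = 3`):
  `coeff_subst_scale`, `subst_scale_of_isWeightedHomogeneous` (`= t^{nj} ·` on degree `j`), `X_pow_dvd_subst_scale_of_mem_pow`
  (`t^{nk} ∣ scale_n(P₀^k)`) and **`exists_subst_scale_eq_of_mem_pow`**: `scale_n(g) = t^{nj}(layer_j g + tⁿρ)` for `g ∈ P₀^j` —
  step (L1) of the memo.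

Everything is OURS, elementary coefficient algebra over any commutative ring `K`; no statement of the manuscript under adjudication
and no published theorem is asserted. [cite: CossartPiltant2009, ch. 3 I.9 (formal arcs; the d = 3 hypersurface computation)]
-/

set_option linter.dupNamespace false -- mandated namespace of this single-conjunct summit
open MvPowerSeries
open Finsupp hiding some

noncomputable section

universe u

namespace Summit.ResolutionOfSingularities.ResolutionOfSingularities.Cruxes.SigmaMaxModifications.IdeasL1C5

namespace ArcLimit

variable {d : ℕ} {K : Type u} [CommRing K]

/-! ### §3. Layers: the `y`-homogeneous components -/

/-- The LAYER of `y`-degree `j` of a series: its `(0,1,…,1)`-weighted homogeneous component of weight `j` (the monomials `t^a y^b`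
with `|b| = j`). [folklore] -/
def layer (j : ℕ) : MvPowerSeries (Fin (d + 1)) K →ₗ[K] MvPowerSeries (Fin (d + 1)) K :=
  weightedHomogeneousComponent (yW d) j

/-- [OURS · L1 W4.2] `coeff_layer` — layer / scaling bookkeeping. [folklore] -/
theorem coeff_layer (j : ℕ) (g : MvPowerSeries (Fin (d + 1)) K) (e : Fin (d + 1) →₀ ℕ) :
    coeff e (layer j g) = if yDeg e = j then coeff e g else 0 :=
  coeff_weightedHomogeneousComponent (yW d) j e g

/-- A layer is `y`-homogeneous of its degree. [folklore] -/
theorem isWeightedHomogeneous_layer (j : ℕ) (g : MvPowerSeries (Fin (d + 1)) K) :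
    IsWeightedHomogeneous (yW d) (layer j g) j :=
  isWeightedHomogeneous_weightedHomogeneousComponent (yW d) g j

/-- A `y`-homogeneous series of degree `j` is its own layer `j`. [folklore] -/
theorem layer_eq_self_of_isWeightedHomogeneous {j : ℕ} {φ : MvPowerSeries (Fin (d + 1)) K}
    (hφ : IsWeightedHomogeneous (yW d) φ j) : layer j φ = φ := by
  ext e
  rw [coeff_layer]
  split_ifs with h
  · rfl
  · exact (hφ.coeff_eq_zero h).symm

/-- … and its other layers vanish. [folklore] -/
theorem layer_eq_zero_of_isWeightedHomogeneous {i j : ℕ} {φ : MvPowerSeries (Fin (d + 1)) K}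
    (hφ : IsWeightedHomogeneous (yW d) φ i) (hij : i ≠ j) : layer j φ = 0 := by
  ext e
  rw [coeff_layer, map_zero]
  split_ifs with h
  · exact hφ.coeff_eq_zero (by rw [yDeg] at h; omega)
  · rfl

/-- [OURS · L1 W4.2] `layer_layer` — layer / scaling bookkeeping. [folklore] -/
theorem layer_layer (j : ℕ) (g : MvPowerSeries (Fin (d + 1)) K) : layer j (layer j g) = layer j g :=
  layer_eq_self_of_isWeightedHomogeneous (isWeightedHomogeneous_layer j g)

/-- A layer of degree `j` lies in `P₀^j`. [folklore] -/
theorem layer_mem_arcIdeal_pow (j : ℕ) (g : MvPowerSeries (Fin (d + 1)) K) : layer j g ∈ arcIdeal d K ^ j := by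
  rw [mem_arcIdeal_pow_iff]
  intro e he
  rw [coeff_layer, if_neg (by omega)]

/-- A `y`-homogeneous series of degree `j` lies in `P₀^j`. [folklore] -/
theorem mem_arcIdeal_pow_of_isWeightedHomogeneous {j : ℕ} {φ : MvPowerSeries (Fin (d + 1)) K}
    (hφ : IsWeightedHomogeneous (yW d) φ j) : φ ∈ arcIdeal d K ^ j := by
  rw [← layer_eq_self_of_isWeightedHomogeneous hφ]; exact layer_mem_arcIdeal_pow j φ

/-- The layers below `j` of an element of `P₀^j` vanish. [folklore] -/
theorem layer_eq_zero_of_mem_pow {i j : ℕ} {g : MvPowerSeries (Fin (d + 1)) K} (hg : g ∈ arcIdeal d K ^ j) (hij : i < j) :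
    layer i g = 0 := by
  rw [mem_arcIdeal_pow_iff] at hg
  ext e
  rw [coeff_layer, map_zero]
  split_ifs with h
  · exact hg e (by omega)
  · rfl

/-- `g ≡ layer j g (mod P₀^{j+1})` for `g ∈ P₀^j`. [folklore] -/
theorem sub_layer_mem_arcIdeal_pow_succ {j : ℕ} {g : MvPowerSeries (Fin (d + 1)) K} (hg : g ∈ arcIdeal d K ^ j) :
    g - layer j g ∈ arcIdeal d K ^ (j + 1) := by
  rw [mem_arcIdeal_pow_iff] at hg ⊢
  intro e he
  rw [map_sub, coeff_layer]
  split_ifs with h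
  · exact sub_self _
  · rw [hg e (by omega), sub_zero]

/-- `P₀^j`-membership is layer-vanishing below `j`. [folklore] -/
theorem mem_arcIdeal_pow_iff_layer {j : ℕ} {g : MvPowerSeries (Fin (d + 1)) K} :
    g ∈ arcIdeal d K ^ j ↔ ∀ i < j, layer i g = 0 := by
  refine ⟨fun hg i hi => layer_eq_zero_of_mem_pow hg hi, fun h => ?_⟩
  rw [mem_arcIdeal_pow_iff]
  intro e he
  have := congrArg (coeff e) (h (yDeg e) he)
  rwa [coeff_layer, if_pos rfl, map_zero] at this

/-- **Product rule for layers**: for `φ` `y`-homogeneous of degree `i ≤ j` and any `a`, `layer j (a * φ) = layer (j - i) a * φ`.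
[folklore] -/
theorem layer_mul_of_isWeightedHomogeneous {i j : ℕ} (hij : i ≤ j) (a : MvPowerSeries (Fin (d + 1)) K)
    {φ : MvPowerSeries (Fin (d + 1)) K} (hφ : IsWeightedHomogeneous (yW d) φ i) :
    layer j (a * φ) = layer (j - i) a * φ := by
  classical
  ext e
  rw [coeff_layer, coeff_mul, coeff_mul]
  split_ifs with h
  · refine Finset.sum_congr rfl fun x hx => ?_
    rw [Finset.mem_antidiagonal] at hx
    rw [coeff_layer]
    split_ifs with h1
    · rfl
    · by_cases h2 : yDeg x.2 = i
      · exfalso; apply h1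
        have := congrArg yDeg hx; rw [yDeg_add] at this; omega
      · rw [hφ.coeff_eq_zero h2, mul_zero, zero_mul]
  · refine (Finset.sum_eq_zero fun x hx => ?_).symm
    rw [Finset.mem_antidiagonal] at hx
    rw [coeff_layer]
    split_ifs with h1
    · by_cases h2 : yDeg x.2 = i
      · exfalso; apply h
        have := congrArg yDeg hx; rw [yDeg_add] at this; omega
      · rw [hφ.coeff_eq_zero h2, mul_zero]
    · rw [zero_mul]

/-- The same with the homogeneous factor on the left. [folklore] -/
theorem layer_mul_of_isWeightedHomogeneous' {i j : ℕ} (hij : i ≤ j) (a : MvPowerSeries (Fin (d + 1)) K)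
    {φ : MvPowerSeries (Fin (d + 1)) K} (hφ : IsWeightedHomogeneous (yW d) φ i) :
    layer j (φ * a) = φ * layer (j - i) a := by
  rw [mul_comm, layer_mul_of_isWeightedHomogeneous hij a hφ, mul_comm]

/-- Layers above the degree of a product with a homogeneous factor of larger degree vanish. [folklore] -/
theorem layer_mul_eq_zero_of_lt {i j : ℕ} (hji : j < i) (a : MvPowerSeries (Fin (d + 1)) K)
    {φ : MvPowerSeries (Fin (d + 1)) K} (hφ : IsWeightedHomogeneous (yW d) φ i) : layer j (a * φ) = 0 :=
  layer_eq_zero_of_mem_pow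
    (by simpa using Ideal.mul_mem_left _ a (mem_arcIdeal_pow_of_isWeightedHomogeneous hφ)) hji

/-- A series of `y`-degree-`0` support (a series "in `t` alone") is `y`-homogeneous of degree `0`; multiplying by it commutes with
every layer. [folklore] -/
theorem layer_mul_of_isWeightedHomogeneous_zero (j : ℕ) (a : MvPowerSeries (Fin (d + 1)) K)
    {c : MvPowerSeries (Fin (d + 1)) K} (hc : IsWeightedHomogeneous (yW d) c 0) : layer j (c * a) = c * layer j a := by
  rw [layer_mul_of_isWeightedHomogeneous' (Nat.zero_le j) a hc, Nat.sub_zero]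

/-- Powers of `t = X 0` are `y`-homogeneous of degree `0`. [folklore] -/
theorem isWeightedHomogeneous_X_zero_pow (k : ℕ) :
    IsWeightedHomogeneous (yW d) ((X 0 : MvPowerSeries (Fin (d + 1)) K) ^ k) 0 := by
  intro e he
  rw [X_pow_eq, coeff_monomial] at he
  split_ifs at he with h
  · subst h; simpa [yDeg] using (yDeg_single_zero (d := d) k)
  · exact absurd rfl he

/-- [OURS · L1 W4.2] `layer_X_zero_pow_mul` — layer / scaling bookkeeping. [folklore] -/
theorem layer_X_zero_pow_mul (k j : ℕ) (a : MvPowerSeries (Fin (d + 1)) K) :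
    layer j (X 0 ^ k * a) = X 0 ^ k * layer j a :=
  layer_mul_of_isWeightedHomogeneous_zero j a (isWeightedHomogeneous_X_zero_pow k)

/-! ### §4. The scaling `t ↦ t, y ↦ tⁿ y` -/

variable (d K) in
/-- The `n`-fold chart substitution `scale n : X 0 ↦ X 0, X i ↦ (X 0)^n X i` (`i ≠ 0`). [folklore] -/
def scale (n : ℕ) : Fin (d + 1) → MvPowerSeries (Fin (d + 1)) K :=
  fun i => if i = 0 then X 0 else X 0 ^ n * X i

/-- [OURS · L1 W4.2] `hasSubst_scale` — layer / scaling bookkeeping. [folklore] -/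
theorem hasSubst_scale (n : ℕ) : HasSubst (scale d K n) :=
  hasSubst_of_constantCoeff_zero fun i => by unfold scale; split_ifs <;> simp

/-- [OURS · L1 W4.2] `scale_zero_apply` — layer / scaling bookkeeping. [folklore] -/
theorem scale_zero_apply (n : ℕ) : scale d K n 0 = X 0 := by simp [scale]

/-- [OURS · L1 W4.2] `scale_apply_of_ne_zero` — layer / scaling bookkeeping. [folklore] -/
theorem scale_apply_of_ne_zero (n : ℕ) {i : Fin (d + 1)} (hi : i ≠ 0) : scale d K n i = X 0 ^ n * X i := by
  simp [scale, hi]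

/-- The exponent shift `(a, b) ↦ (a + n|b|, b)`. [folklore] -/
def shift (n : ℕ) (e : Fin (d + 1) →₀ ℕ) : Fin (d + 1) →₀ ℕ := e + single 0 (n * yDeg e)

/-- [OURS · L1 W4.2] `yDeg_shift` — layer / scaling bookkeeping. [folklore] -/
@[simp] theorem yDeg_shift (n : ℕ) (e : Fin (d + 1) →₀ ℕ) : yDeg (shift n e) = yDeg e := by
  simp [shift]

/-- [OURS · L1 W4.2] `shift_apply_zero` — layer / scaling bookkeeping. [folklore] -/
theorem shift_apply_zero (n : ℕ) (e : Fin (d + 1) →₀ ℕ) : shift n e 0 = e 0 + n * yDeg e := by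
  simp [shift]

/-- [OURS · L1 W4.2] `shift_apply_of_ne_zero` — layer / scaling bookkeeping. [folklore] -/
theorem shift_apply_of_ne_zero (n : ℕ) (e : Fin (d + 1) →₀ ℕ) {i : Fin (d + 1)} (hi : i ≠ 0) : shift n e i = e i := by
  simp [shift, hi.symm]

/-- [OURS · L1 W4.2] `shift_injective` — layer / scaling bookkeeping. [folklore] -/
theorem shift_injective (n : ℕ) : Function.Injective (shift (d := d) n) := by
  intro e e' h
  have hy : yDeg e = yDeg e' := by rw [← yDeg_shift n e, h, yDeg_shift]
  have : e + single 0 (n * yDeg e) = e' + single 0 (n * yDeg e) := by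
    have h' := h; simp only [shift] at h'; rw [hy] at h' ⊢; exact h'
  exact add_right_cancel this

/-- [OURS · L1 W4.2] `shift_sub_eq` — layer / scaling bookkeeping. [folklore] -/
theorem shift_sub_eq {n : ℕ} {e : Fin (d + 1) →₀ ℕ} (he : n * yDeg e ≤ e 0) :
    shift n (e - single 0 (n * yDeg e)) = e := by
  have hy : yDeg (e - single 0 (n * yDeg e)) = yDeg e := by
    have : e - single 0 (n * yDeg e) + single 0 (n * yDeg e) = e := by
      ext i
      simp only [Finsupp.coe_add, Finsupp.coe_tsub, Pi.add_apply, Pi.sub_apply, single_apply]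
      split_ifs with h
      · subst h; omega
      · omega
    have h2 := congrArg yDeg this
    rw [yDeg_add, yDeg_single_zero, add_zero] at h2
    exact h2
  ext i
  simp only [shift, hy, Finsupp.coe_add, Finsupp.coe_tsub, Pi.add_apply, Pi.sub_apply, single_apply]
  split_ifs with h
  · subst h; omega
  · omega

/-- Products of monic monomials. [folklore] -/
theorem prod_monomial_one {ι : Type*} (s : Finset ι) (f : ι → (Fin (d + 1) →₀ ℕ)) :
    ∏ i ∈ s, monomial (f i) (1 : K) = monomial (∑ i ∈ s, f i) (1 : K) := by
  classical
  induction s using Finset.induction_on with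
  | empty => simp
  | insert a s ha ih => rw [Finset.prod_insert ha, Finset.sum_insert ha, ih, monomial_mul_monomial, one_mul]

/-- The exponent of the monomial `(scale n i)^{e i}`. [folklore] -/
def scaleExp (n : ℕ) (e : Fin (d + 1) →₀ ℕ) (i : Fin (d + 1)) : Fin (d + 1) →₀ ℕ :=
  if i = 0 then single 0 (e 0) else single 0 (n * e i) + single i (e i)

/-- [OURS · L1 W4.2] `scale_pow_eq_monomial` — layer / scaling bookkeeping. [folklore] -/
theorem scale_pow_eq_monomial (n : ℕ) (e : Fin (d + 1) →₀ ℕ) (i : Fin (d + 1)) :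
    scale d K n i ^ e i = monomial (scaleExp n e i) (1 : K) := by
  by_cases hi : i = 0
  · subst hi; simp [scale_zero_apply, X_pow_eq, scaleExp]
  · rw [scale_apply_of_ne_zero n hi, mul_pow, ← pow_mul, X_pow_eq, X_pow_eq, monomial_mul_monomial, one_mul]
    simp [scaleExp, hi]

/-- [OURS · L1 W4.2] `sum_scaleExp` — layer / scaling bookkeeping. [folklore] -/
theorem sum_scaleExp (n : ℕ) (e : Fin (d + 1) →₀ ℕ) : ∑ i, scaleExp n e i = shift n e := by
  classical
  ext j
  rw [Finsupp.coe_finsetSum, Finset.sum_apply, Fin.sum_univ_succ]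
  by_cases hj : j = 0
  · subst hj
    rw [shift_apply_zero, yDeg_eq_sum, Finset.mul_sum]
    simp [scaleExp, Fin.succ_ne_zero]
  · obtain ⟨j', rfl⟩ := Fin.exists_succ_eq.mpr hj
    rw [shift_apply_of_ne_zero n e hj]
    simp only [scaleExp, Fin.succ_ne_zero, ↓reduceIte, Finsupp.coe_add, Pi.add_apply, single_apply]
    rw [Finset.sum_eq_single j']
    · simp [(Fin.succ_ne_zero j').symm]
    · intro b _ hb; simp [(Fin.succ_ne_zero j').symm, Fin.succ_inj.ne.mpr hb]
    · simp

/-- The monomial `∏ (scale n i)^{e i}` is `t^{e 0 + n|b|} y^b`. [folklore] -/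
theorem prod_scale_pow (n : ℕ) (e : Fin (d + 1) →₀ ℕ) :
    (e.prod fun i k => scale d K n i ^ k) = monomial (shift n e) (1 : K) := by
  classical
  rw [Finsupp.prod_fintype _ _ (fun i => by simp)]
  simp_rw [scale_pow_eq_monomial, prod_monomial_one, sum_scaleExp]

/-- **Coefficients of the `n`-th total transform**: the coefficient of `t^a y^b` in `g(t, tⁿy)` is the coefficient of `t^{a−n|b|} y^b`
in `g` if `n|b| ≤ a`, else `0`. [folklore] -/
theorem coeff_subst_scale (n : ℕ) (g : MvPowerSeries (Fin (d + 1)) K) (e : Fin (d + 1) →₀ ℕ) :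
    coeff e (subst (scale d K n) g) = if n * yDeg e ≤ e 0 then coeff (e - single 0 (n * yDeg e)) g else 0 := by
  rw [coeff_subst (hasSubst_scale n)]
  simp_rw [prod_scale_pow, coeff_monomial]
  split_ifs with hle
  · rw [finsum_eq_single _ (e - single 0 (n * yDeg e))]
    · rw [if_pos (shift_sub_eq hle).symm]; simp
    · intro d' hd
      rw [if_neg]
      · simp
      · intro hed
        apply hd
        apply shift_injective n
        rw [shift_sub_eq hle, hed]
  · rw [finsum_eq_zero_of_forall_eq_zero]
    intro d'
    rw [if_neg]
    · simp
    · intro hed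
      apply hle
      rw [hed, shift_apply_zero, yDeg_shift]
      omega

/-- Coefficient extraction at a shifted exponent. [folklore] -/
theorem coeff_shift_subst_scale (n : ℕ) (g : MvPowerSeries (Fin (d + 1)) K) (e : Fin (d + 1) →₀ ℕ) :
    coeff (shift n e) (subst (scale d K n) g) = coeff e g := by
  rw [coeff_subst_scale]
  have hle : n * yDeg (shift n e) ≤ shift n e 0 := by rw [yDeg_shift, shift_apply_zero]; omega
  rw [if_pos hle]
  have hs : shift n e - single 0 (n * yDeg (shift n e)) = e := shift_injective n (by rw [shift_sub_eq hle])
  rw [hs]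

/-- **Scaling a layer**: a `y`-homogeneous series of degree `j` is multiplied by `t^{nj}`. [folklore] -/
theorem subst_scale_of_isWeightedHomogeneous (n : ℕ) {j : ℕ} {φ : MvPowerSeries (Fin (d + 1)) K}
    (hφ : IsWeightedHomogeneous (yW d) φ j) : subst (scale d K n) φ = X 0 ^ (n * j) * φ := by
  ext e
  rw [coeff_subst_scale, X_pow_eq, coeff_monomial_mul, one_mul]
  by_cases hy : yDeg e = j
  · rw [hy]
    split_ifs with h1 h2 h2
    · rfl
    · exfalso; apply h2; rw [single_le_iff]; simpa using h1
    · exfalso; apply h1; have := h2; rw [single_le_iff] at this; simpa using this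
    · rfl
  · -- both sides vanish: the exponent read in `φ` has `y`-degree `yDeg e ≠ j`
    have hz1 : coeff (e - single 0 (n * yDeg e)) φ = 0 := hφ.coeff_eq_zero (by
      show yDeg (e - single 0 (n * yDeg e)) ≠ j
      intro h; apply hy
      by_cases hle : n * yDeg e ≤ e 0
      · rw [← yDeg_shift n (e - single 0 (n * yDeg e)), shift_sub_eq hle] at h; exact h
      · -- if the subtraction truncates, `y`-degrees still agree off the `0`-th coordinate
        rw [yDeg_eq_sum] at h ⊢
        simpa [single_apply, (Fin.succ_ne_zero _).symm, Fin.succ_ne_zero] using h)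
    have hz2 : coeff (e - single 0 (n * j)) φ = 0 := hφ.coeff_eq_zero (by
      show yDeg (e - single 0 (n * j)) ≠ j
      intro h; apply hy
      rw [yDeg_eq_sum] at h ⊢
      simpa [single_apply, (Fin.succ_ne_zero _).symm, Fin.succ_ne_zero] using h)
    simp [hz1, hz2]

/-- `t` is fixed by the scaling. [folklore] -/
theorem subst_scale_X_zero (n : ℕ) : subst (scale d K n) (X 0 : MvPowerSeries (Fin (d + 1)) K) = X 0 := by
  rw [subst_X (hasSubst_scale n), scale_zero_apply]

/-- [OURS · L1 W4.2] `subst_scale_X_zero_pow` — layer / scaling bookkeeping. [folklore] -/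
theorem subst_scale_X_zero_pow (n k : ℕ) : subst (scale d K n) ((X 0 : MvPowerSeries (Fin (d + 1)) K) ^ k) = X 0 ^ k := by
  rw [subst_pow (hasSubst_scale n), subst_scale_X_zero]

/-- **`t^{nk} ∣ scale_n(P₀^k)`**. [folklore] -/
theorem X_pow_dvd_subst_scale_of_mem_pow (n : ℕ) {k : ℕ} {r : MvPowerSeries (Fin (d + 1)) K} (hr : r ∈ arcIdeal d K ^ k) :
    X 0 ^ (n * k) ∣ subst (scale d K n) r := by
  rw [mem_arcIdeal_pow_iff] at hr
  rw [X_pow_dvd_iff]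
  intro e he
  rw [coeff_subst_scale]
  split_ifs with hle
  · apply hr
    by_contra hlt
    push Not at hlt
    have : yDeg (e - single 0 (n * yDeg e)) = yDeg e := by
      rw [← yDeg_shift n (e - single 0 (n * yDeg e)), shift_sub_eq hle]
    rw [this] at hlt
    have : n * k ≤ n * yDeg e := Nat.mul_le_mul_left n hlt
    omega
  · rfl

/-- **The `n`-th transform of an element of `P₀^j` splits off its layer**: `scale_n(g) = t^{nj} · (layer_j g + tⁿ ρ)`. [folklore] -/
theorem exists_subst_scale_eq_of_mem_pow (n : ℕ) {j : ℕ} {g : MvPowerSeries (Fin (d + 1)) K} (hg : g ∈ arcIdeal d K ^ j) :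
    ∃ ρ : MvPowerSeries (Fin (d + 1)) K, subst (scale d K n) g = X 0 ^ (n * j) * (layer j g + X 0 ^ n * ρ) := by
  obtain ⟨ρ, hρ⟩ := X_pow_dvd_subst_scale_of_mem_pow n (sub_layer_mem_arcIdeal_pow_succ hg)
  refine ⟨ρ, ?_⟩
  have hsplit : g = layer j g + (g - layer j g) := by ring
  have hcoe : subst (scale d K n) g = subst (scale d K n) (layer j g) + subst (scale d K n) (g - layer j g) := by
    conv_lhs => rw [hsplit]
    rw [← coe_substAlgHom (hasSubst_scale n), map_add]
  rw [hcoe, hρ, subst_scale_of_isWeightedHomogeneous n (isWeightedHomogeneous_layer j g)]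
  ring

end ArcLimit

end Summit.ResolutionOfSingularities.ResolutionOfSingularities.Cruxes.SigmaMaxModifications.IdeasL1C5

end
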